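import Summits.Ventures.PercRepro.ProfilePointedCircuitClassesStarSharpParXD

/-!
# PercRepro — THE REGIME `b ∥ y ∈ X`, PART D1: THE KEY LEMMA
(p5, gen 55, split off part D in gen 56 for the 400-line limit; `proofs/P5-GM1.md` §82 ADD 7–8)

`parX_not_two_B_of_A`: a bad demand with `c1` and two distinct bad demands without `c1` cannot coexist.
-/

open scoped Matroid

namespace PercRepro.Cogirth

open Finset ThmH Skew Shadow Profile

open Classical

variable {α : Type} [DecidableEq α] {N : Matroid α} [N.Finite]

section StarSharpParXD1

variable {b b' : α}

/-- **THE KEY LEMMA** (regime `b ∥ y`): a bad demand with `c1` and two distinct bad demands without `c1` cannot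
coexist. -/
theorem parX_not_two_B_of_A (hn : (gr N).card = 9) (h : SeriesPair N b b') {e f : α} (he : e ∈ gr N) (hf : f ∈ gr N)
    (hef : e ≠ f) (heb : e ≠ b) (heb' : e ≠ b') (hfb : f ≠ b) (hfb' : f ≠ b')
    (he1 : ∀ y ∈ ((((gr N).erase b).erase b').erase f).erase e, rk N {e, y} = 2)
    (hf1 : ∀ y ∈ ((((gr N).erase b).erase b').erase f).erase e, rk N {f, y} = 2)
    (hfc : ∀ y ∈ ((((gr N).erase b).erase b').erase f).erase e, rk N (((((gr N).erase b).erase b').erase f).erase y) = 4)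
    (hX : rk N (((((gr N).erase b).erase b').erase f).erase e) = 4)
    {y : α} (hyX : y ∈ ((((gr N).erase b).erase b').erase f).erase e) (hpar : rk N {y, b, b'} = 2)
    (hbb2 : rk N {b, b'} = 2) {W : Finset α} (hW : W ∈ d0DON N b' e f) (hc0 : ¬ d0c0 N b b' e f W)
    (hc1 : d0c1 N b e f W) (hc2 : ¬ d0c2 N b b' e f W) {W₁ W₂ : Finset α} (hW₁ : W₁ ∈ d0DON N b' e f)
    (hc0₁ : ¬ d0c0 N b b' e f W₁) (hc1₁ : ¬ d0c1 N b e f W₁) (hW₂ : W₂ ∈ d0DON N b' e f) (hc0₂ : ¬ d0c0 N b b' e f W₂)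
    (hc1₂ : ¬ d0c1 N b e f W₂) : W₁ = W₂ := by
  by_contra hne
  have hXE : ((((gr N).erase b).erase b').erase f).erase e ⊆ ((gr N).erase b).erase b' :=
    (erase_subset _ _).trans (erase_subset _ _)
  have hXg : ((((gr N).erase b).erase b').erase f).erase e ⊆ gr N :=
    hXE.trans ((erase_subset _ _).trans (erase_subset _ _))
  have heE : e ∈ ((gr N).erase b).erase b' := mem_erase.2 ⟨heb', mem_erase.2 ⟨heb, he⟩⟩
  have hy1 : rk N ({y} : Finset α) = 1 := by
    have h1 := rk_insert_le_add_one (N := N) he (X := ({y} : Finset α)) (singleton_subset_iff.2 (hXg hyX))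
    have h2 := rk_le_card' (M := N) ({y} : Finset α)
    rw [card_singleton] at h2
    rw [he1 y hyX] at h1
    omega
  have hX5 := card_X_eq_five hn h he hf hef heb heb' hfb hfb'
  have hdata := d0_demand_data h hn hf hef heb hfb hfb' (e := e)
  have hWd := hW
  simp only [d0DON, mem_filter] at hWd
  obtain ⟨-, hπX, hπ2, -, -, hπe, hYf, hon⟩ := hdata W hWd.1 hWd.2.1 hWd.2.2
  have hWd₁ := hW₁
  simp only [d0DON, mem_filter] at hWd₁
  obtain ⟨-, hπX₁, hπ2₁, hπW₁, hbW₁, hπe₁, hYf₁, -⟩ := hdata W₁ hWd₁.1 hWd₁.2.1 hWd₁.2.2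
  have hWd₂ := hW₂
  simp only [d0DON, mem_filter] at hWd₂
  obtain ⟨-, hπX₂, hπ2₂, hπW₂, hbW₂, hπe₂, hYf₂, -⟩ := hdata W₂ hWd₂.1 hWd₂.2.1 hWd₂.2.2
  -- the OFF C-endpoint `z` of the `c1`-demand, and `ρ{e, f, y} = 3`
  obtain ⟨z, hzπ, hz3, hz4, hzoff⟩ := parX_off_cpoint_of_c1 hn h he hf hef heb heb' hfb hfb' he1 hf1 hfc hX hyX hpar
    hbb2 hW hc0 hc1 hc2
  have hzX := hπX hzπ
  have hefy : rk N {e, f, y} = 3 := by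
    by_contra hne'
    have h1 : rk N {e, f} ≤ rk N (insert y {e, f}) := rk_mono' (subset_insert _ _)
    have h2 := rk_insert_le_add_one (N := N) (hXg hyX) (X := {e, f}) (insert_subset he (singleton_subset_iff.2 hf))
    have hef2 : rk N {e, f} = 2 := by
      have h3 := rk_insert_le_add_one (N := N) he (X := {f}) (singleton_subset_iff.2 hf)
      have h4 : rk N {f} ≤ rk N {e, f} := rk_mono' (singleton_subset_iff.2 (mem_insert_of_mem (mem_singleton_self _)))
      have h5 := hf1 z hzX
      have h6 : rk N {f} ≤ rk N {f, z} := rk_mono' (singleton_subset_iff.2 (mem_insert_self _ _))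
      have h7 := rk_le_card' (M := N) ({f} : Finset α)
      have h8 := rk_le_card' (M := N) ({e, f} : Finset α)
      rw [card_singleton] at h7
      rw [card_pair hef] at h8
      have h9 : rk N {e, f} ≤ rk N {e, f, z} := rk_mono' (by
        intro u hu; simp only [mem_insert, mem_singleton] at hu
        rcases hu with rfl | rfl
        · exact mem_insert_self _ _
        · exact mem_insert_of_mem (mem_insert_self _ _))
      have h10 := rk_insert_le_add_one (N := N) (hXg hzX) (X := {e, f}) (insert_subset he (singleton_subset_iff.2 hf))
      rw [← triple_eq_insert_last] at h10
      rw [hz3] at h9 h10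
      omega
    rw [← triple_eq_insert_last] at h1 h2
    have h3 : rk N (insert y {e, f}) = rk N {e, f} := by rw [← triple_eq_insert_last, hef2]; omega
    have h4 := rk_insert_eq_of_rk_insert_eq_subset' (N := N) (S := {e, f}) (S' := {e, f, z}) (w := y) (by
      intro u hu; simp only [mem_insert, mem_singleton] at hu
      rcases hu with rfl | rfl
      · exact mem_insert_self _ _
      · exact mem_insert_of_mem (mem_insert_self _ _)) h3
    rw [hz3, hzoff] at h4
    omega
  -- the points `M` of `X` on the plane `cl{e, f, y}`
  have hM3 := parX_card_plane_le_three hn h he hf hef heb heb' hfb hfb' hfc hX hefy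
  have hMrk : rk N ({e, f, y} ∪ (((((gr N).erase b).erase b').erase f).erase e).filter
      (fun s => rk N (insert s {e, f, y}) = 3)) = 3 := by
    rw [rk_union_eq_of_forall_insert_eq (N := N) (Y := {e, f, y}) _ (fun s hs => by
      rw [(mem_filter.1 hs).2, hefy]), hefy]
  obtain ⟨M, hMdef⟩ : ∃ M : Finset α, M = (((((gr N).erase b).erase b').erase f).erase e).filter
      (fun s => rk N (insert s {e, f, y}) = 3) := ⟨_, rfl⟩
  rw [← hMdef] at hM3 hMrk
  have hMmem : ∀ u, u ∈ M ↔ u ∈ ((((gr N).erase b).erase b').erase f).erase e ∧ rk N (insert u {e, f, y}) = 3 := by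
    intro u; rw [hMdef, mem_filter]
  have hπ₁M : (W₁.erase b).erase e ⊆ M := fun s hs => (hMmem s).2 ⟨hπX₁ hs,
    parX_mem_plane_of_not_c1 hn h he hf hef heb heb' hfb hfb' he1 hyX hpar hbb2 hefy hW₁ hc1₁ hs⟩
  have hπ₂M : (W₂.erase b).erase e ⊆ M := fun s hs => (hMmem s).2 ⟨hπX₂ hs,
    parX_mem_plane_of_not_c1 hn h he hf hef heb heb' hfb hfb' he1 hyX hpar hbb2 hefy hW₂ hc1₂ hs⟩
  have hyM : y ∈ M :=
    (hMmem y).2 ⟨hyX, by rw [insert_eq_of_mem (mem_insert_of_mem (mem_insert_of_mem (mem_singleton_self _))), hefy]⟩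
  have hzM : z ∉ M := by
    intro hzM
    have h1 := ((hMmem z).1 hzM).2
    have h2 : rk N (insert y {e, f, z}) ≤ rk N (insert z {e, f, y}) := rk_mono' (by
      intro u hu; simp only [mem_insert, mem_singleton] at hu ⊢
      rcases hu with rfl | rfl | rfl | rfl
      · exact Or.inr (Or.inr (Or.inr rfl))
      · exact Or.inr (Or.inl rfl)
      · exact Or.inr (Or.inr (Or.inl rfl))
      · exact Or.inl rfl)
    rw [h1, hzoff] at h2
    omega
  have hπne : (W₁.erase b).erase e ≠ (W₂.erase b).erase e := by
    intro h'
    apply hne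
    rw [← hbW₁, ← hπW₁, h', hπW₂, hbW₂]
  -- `π₁ ∪ π₂` has three points and is the whole plane trace `M`
  have hU3 : ((W₁.erase b).erase e ∪ (W₂.erase b).erase e).card = 3 := by
    have h1 := card_union_add_card_inter ((W₁.erase b).erase e) ((W₂.erase b).erase e)
    have h2 : ((W₁.erase b).erase e ∩ (W₂.erase b).erase e).card < 2 := by
      by_contra h3
      apply hπne
      have h4 : (W₁.erase b).erase e ∩ (W₂.erase b).erase e = (W₁.erase b).erase e :=
        eq_of_subset_of_card_le inter_subset_left (by omega)
      apply eq_of_subset_of_card_le _ (by omega)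
      intro u hu
      exact (mem_inter.1 (h4.symm ▸ hu)).2
    have h3 := card_le_card (union_subset hπ₁M hπ₂M)
    omega
  have hMeq : M = (W₁.erase b).erase e ∪ (W₂.erase b).erase e :=
    (eq_of_subset_of_card_le (union_subset hπ₁M hπ₂M) (by omega)).symm
  -- the other endpoint `t` of the `c1`-demand lies on the plane, hence on the line `ey`
  obtain ⟨t, htπ, htz⟩ := exists_mem_ne (by omega : 1 < ((W.erase b).erase e).card) z
  have hπeq : (W.erase b).erase e = {z, t} := eq_pair_of_card_two hπ2 hzπ htπ htz.symm
  have htX := hπX htπ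
  have hty : t ≠ y := fun h' => parX_not_mem_of_c1 hn h he hf hef heb heb' hfb hfb' he1 hfc hyX hpar hbb2 hW hc0 hc1 hc2
    (h' ▸ htπ)
  have htM : t ∈ M := by
    by_contra htM
    -- then `M = X − π` and `(X − π) + f` would have rank `≤ 3`
    have hsub : M ⊆ ((((gr N).erase b).erase b').erase f).erase e \ (W.erase b).erase e := by
      intro u hu
      refine mem_sdiff.2 ⟨((hMmem u).1 hu).1, ?_⟩
      rw [hπeq, mem_insert, mem_singleton]
      rintro (rfl | rfl)
      · exact hzM hu
      · exact htM hu
    have hτ3 : (((((gr N).erase b).erase b').erase f).erase e \ (W.erase b).erase e).card = 3 := by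
      rw [card_sdiff_of_subset hπX, hX5, hπ2]
    have heq := eq_of_subset_of_card_le hsub (by rw [hτ3, hMeq, hU3])
    have h1 : rk N (insert f (((((gr N).erase b).erase b').erase f).erase e \ (W.erase b).erase e)) ≤
        rk N ({e, f, y} ∪ M) := by
      apply rk_mono'
      intro u hu
      rw [mem_insert] at hu
      rcases hu with rfl | hu
      · exact mem_union_left _ (mem_insert_of_mem (mem_insert_self _ _))
      · rw [← heq] at hu; exact mem_union_right _ hu
    rw [hYf, hMrk] at h1
    omega
  have htplane : rk N (insert t {e, f, y}) = 3 := ((hMmem t).1 htM).2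
  have hyπ : rk N (insert y (insert e ((W.erase b).erase e))) = rk N (insert e ((W.erase b).erase e)) :=
    (on_iff_of_parallel h (hXE hyX) hy1 hpar hbb2 (insert_subset heE (hπX.trans hXE))).1 (by rw [hπe]; exact hon)
  have hline : rk N (insert y {e, t}) ≤ 2 := by
    apply rk_le_two_of_two_planes (N := N) (S₁ := insert y (insert e ((W.erase b).erase e))) (S₂ := insert t {e, f, y})
      (U := insert y {e, f, z})
    · intro u hu; simp only [mem_insert, mem_singleton] at hu
      rcases hu with rfl | rfl | rfl
      · exact mem_inter.2 ⟨mem_insert_self _ _,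
          mem_insert_of_mem (mem_insert_of_mem (mem_insert_of_mem (mem_singleton_self _)))⟩
      · exact mem_inter.2 ⟨mem_insert_of_mem (mem_insert_self _ _), mem_insert_of_mem (mem_insert_self _ _)⟩
      · exact mem_inter.2 ⟨mem_insert_of_mem (mem_insert_of_mem htπ), mem_insert_self _ _⟩
    · intro u hu; simp only [mem_insert, mem_singleton] at hu
      rcases hu with rfl | rfl | rfl | rfl
      · exact mem_union_right _ (mem_insert_of_mem (mem_insert_of_mem (mem_insert_of_mem (mem_singleton_self _))))
      · exact mem_union_right _ (mem_insert_of_mem (mem_insert_self _ _))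
      · exact mem_union_right _ (mem_insert_of_mem (mem_insert_of_mem (mem_insert_self _ _)))
      · exact mem_union_left _ (mem_insert_of_mem (mem_insert_of_mem hzπ))
    · exact hzoff
    · rw [hyπ, hπe]
    · rw [htplane]
  -- the third point `s′` of the plane trace
  have hc1' : ((M.erase t).erase y).card = 1 := by
    rw [card_erase_of_mem (mem_erase.2 ⟨hty.symm, hyM⟩), card_erase_of_mem htM, hMeq, hU3]
  obtain ⟨s', hs'⟩ := card_eq_one.1 hc1'
  have hs'mem : s' ∈ (M.erase t).erase y := by rw [hs']; exact mem_singleton_self _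
  have hs'y : s' ≠ y := (mem_erase.1 hs'mem).1
  have hs't : s' ≠ t := (mem_erase.1 (mem_erase.1 hs'mem).2).1
  have hs'M := (mem_erase.1 (mem_erase.1 hs'mem).2).2
  have hs'X := ((hMmem s').1 hs'M).1
  have hMsub : M ⊆ {t, s'} ∪ {t, y} := by
    intro u hu
    by_cases hut : u = t
    · rw [hut]; exact mem_union_left _ (mem_insert_self _ _)
    by_cases huy : u = y
    · rw [huy]; exact mem_union_right _ (mem_insert_of_mem (mem_singleton_self _))
    have : u ∈ (M.erase t).erase y := mem_erase.2 ⟨huy, mem_erase.2 ⟨hut, hu⟩⟩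
    rw [hs', mem_singleton] at this
    rw [this]; exact mem_union_left _ (mem_insert_of_mem (mem_singleton_self _))
  -- neither pair is `{t, y}` (`ρ({t, y} + e) ≤ 2`); so one of them is `{s′, y}`
  have hnotty : ∀ W' ∈ d0DON N b' e f, (W'.erase b).erase e ≠ {t, y} := by
    intro W' hW' h'
    have hWd' := hW'
    simp only [d0DON, mem_filter] at hWd'
    have hπe' := (hdata W' hWd'.1 hWd'.2.1 hWd'.2.2).2.2.2.2.2.1
    rw [h', insert_pair_swap] at hπe'
    omega
  have hsy : ∃ W' ∈ d0DON N b' e f, ¬ d0c0 N b b' e f W' ∧ ¬ d0c1 N b e f W' ∧ (W'.erase b).erase e = {s', y} := by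
    rcases pair_eq_of_subset_union_pair hπ2₁ (hπ₁M.trans hMsub) with h1 | h1 | h1
    · rcases pair_eq_of_subset_union_pair hπ2₂ (hπ₂M.trans hMsub) with h2 | h2 | h2
      · exact absurd (h1.trans h2.symm) hπne
      · exact absurd h2 (hnotty W₂ hW₂)
      · exact ⟨W₂, hW₂, hc0₂, hc1₂, h2⟩
    · exact absurd h1 (hnotty W₁ hW₁)
    · exact ⟨W₁, hW₁, hc0₁, hc1₁, h1⟩
  obtain ⟨W', hW', hc0', hc1', hσ⟩ := hsy
  have hWd' := hW'
  simp only [d0DON, mem_filter] at hWd'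
  obtain ⟨-, hπX', hπ2', -, -, hπe', hYf', -⟩ := hdata W' hWd'.1 hWd'.2.1 hWd'.2.2
  have hP' := parX_no_swap_of_not_c1 hn h he hf hef heb heb' hfb hfb' he1 hyX hpar hbb2 hW' hc0' hc1'
  have hσdef : (W'.erase b).erase e ∈ d0Def N b b' e f := mem_d0Def.2 ⟨hπX', hπ2', hπe', hYf', hP'⟩
  rcases b1_or_b2_of_mem_d0Def hn h he hf hef heb heb' hfb hfb' hσdef with hB1 | hB2
  · -- B1: `e ∈ cl(X − {s′, y}) ∋ t`, so `y ∈ cl{e, t}` lies there too: `(X + e) − s′` has rank `≤ 3`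
    have hyline : rk N (insert y {e, t}) = rk N {e, t} := by
      have h1 : rk N {e, t} ≤ rk N (insert y {e, t}) := rk_mono' (subset_insert _ _)
      rw [he1 t htX] at h1 ⊢
      omega
    have hsub : ({e, t} : Finset α) ⊆ insert e (((((gr N).erase b).erase b').erase f).erase e \ (W'.erase b).erase e) := by
      intro u hu; simp only [mem_insert, mem_singleton] at hu
      rcases hu with rfl | rfl
      · exact mem_insert_self _ _
      · refine mem_insert_of_mem (mem_sdiff.2 ⟨htX, ?_⟩)
        rw [hσ, mem_insert, mem_singleton]; push Not; exact ⟨hs't.symm, hty⟩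
    have h1 := rk_insert_eq_of_rk_insert_eq_subset' (N := N) hsub hyline
    rw [hB1] at h1
    have h2 : insert e ((((((gr N).erase b).erase b').erase f).erase e).erase s') ⊆
        insert y (insert e (((((gr N).erase b).erase b').erase f).erase e \ (W'.erase b).erase e)) := by
      intro u hu
      rw [mem_insert] at hu
      rcases hu with rfl | hu
      · exact mem_insert_of_mem (mem_insert_self _ _)
      by_cases huy : u = y
      · rw [huy]; exact mem_insert_self _ _
      refine mem_insert_of_mem (mem_insert_of_mem (mem_sdiff.2 ⟨(mem_erase.1 hu).2, ?_⟩))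
      rw [hσ, mem_insert, mem_singleton]; push Not; exact ⟨(mem_erase.1 hu).1, huy⟩
    have h3 := rk_mono' (M := N) h2
    rw [insert_e_X_erase_eq he hef heb heb' hs'X, hfc s' hs'X, h1] at h3
    omega
  · -- B2: `f ∈ cl{s′, y}`, but `(X − {z, t}) + f ⊇ {s′, y, f}` is a basis
    rw [hσ] at hB2
    have hsub : ({s', y} : Finset α) ⊆ ((((gr N).erase b).erase b').erase f).erase e \ (W.erase b).erase e := by
      intro u hu; simp only [mem_insert, mem_singleton] at hu
      rcases hu with rfl | rfl
      · refine mem_sdiff.2 ⟨hs'X, ?_⟩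
        rw [hπeq, mem_insert, mem_singleton]; push Not
        exact ⟨fun h' => hzM (h' ▸ hs'M), hs't⟩
      · refine mem_sdiff.2 ⟨hyX, ?_⟩
        rw [hπeq, mem_insert, mem_singleton]; push Not
        exact ⟨fun h' => hzM (h' ▸ hyM), hty.symm⟩
    have hτ3 : (((((gr N).erase b).erase b').erase f).erase e \ (W.erase b).erase e).card = 3 := by
      rw [card_sdiff_of_subset hπX, hX5, hπ2]
    have h1 := rk_union_le_rk_add_card (N := N) (insert f {s', y})
      ((((((gr N).erase b).erase b').erase f).erase e \ (W.erase b).erase e) \ {s', y})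
    have h2 : rk N (insert f (((((gr N).erase b).erase b').erase f).erase e \ (W.erase b).erase e)) ≤
        rk N (insert f {s', y} ∪ ((((((gr N).erase b).erase b').erase f).erase e \ (W.erase b).erase e) \ {s', y})) := by
      apply rk_mono'
      intro u hu
      rw [mem_insert] at hu
      rcases hu with rfl | hu
      · exact mem_union_left _ (mem_insert_self _ _)
      by_cases hu2 : u ∈ ({s', y} : Finset α)
      · exact mem_union_left _ (mem_insert_of_mem hu2)
      · exact mem_union_right _ (mem_sdiff.2 ⟨hu, hu2⟩)
    rw [card_sdiff_of_subset hsub, hτ3, card_pair hs'y, hB2] at h1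
    rw [hYf] at h2
    omega

end StarSharpParXD1

end PercRepro.Cogirth
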